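import Summits.BirchSwinnertonDyer.BirchSwinnertonDyer.Theorems.CyclotomicUntwistStabilisedUntwistOfAtkinLi
import Mathlib.RingTheory.ZMod.UnitsCyclic
import HarnessLib

/-!
# The ROOT LAW in eigenform currency from the UNIFORM root law of the Galois side — bridge lemmas
# (route `CyclotomicUntwist`, crux K1 `PSRankOneLowerHalfAtThree`, child C1 = stmt-27548)

Cell `pub/bsd-wall` (D-0145 line `route-BirchSwinnertonDyer-CyclotomicUntwist`), width seat `bsd-line-cycu-p5`
(gen 13). THEOREMS ONLY (no definition, no named fact, no `sorry`); helper `--supports stmt-BirchSwinnertonDyer-27548`.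
BSD is not proved by this file; C1 is NOT closed by it; K1/K2 stay OPEN and WHOLE.

WHAT. `PSC1OfStabilisedUntwist.psUntwistedLFunctionAtThree_of_print_of_stabilisedUntwist_of_rootLaw` (p647270) takes
the ROOT LAW in EIGENFORM currency (`hN2`: on every PS row some primitive `η` mod `9` with `η² ≠ 1` makes `a₃(g₀)` a
root of `X² − a_w(W)X + 3` for every newform `g₀`, `3 ∣` level, with `aₙ(g₀) = η⁻¹(n)aₙ(f_W)` for all `3 ∤ n`).
The K1 lead (cycu-p1 g8, lane 2, files `CyclotomicUntwistCoinvariantEigenvalue` / `…InertiaOverCyclotomicNine` /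
file 3 announced 2026-08-28T16:20Z) delivers it in the UNIFORM GALOIS currency agreed with cycu-p4 g12: «`∃ η`
primitive, `∃ α` with `α² − a_wα + 3 = 0`, `∀ T₀ ≠ 0`, every newform `g₀` whose PRIME-indexed packet off `T₀` is
`a_ℓ(g₀) = η⁻¹(ℓ)·a_ℓ(W)`, `ε_{g₀}(ℓ) = η⁻¹(ℓ)²` has `a₃(g₀) = α`». This file bridges the two currencies in kernel:

* §1 `sq_ne_one_of_isPrimitive_nine` — a PRIMITIVE character mod `9` has `η² ≠ 1` (the kernel of
  `(ℤ/9)ˣ → (ℤ/3)ˣ` has order `3`, so its elements are fourth powers `x = (x²)²`, on which a character of order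
  `≤ 2` is trivial; hence `η² = 1` would make `η` factor through `3`).
* §2 `nebentypus_eq_of_packet` — the nebentypus from the coefficient packet (the argument of (11.1.8) of
  Best et al. 2021): if `a_ℓ(g₀) = c·a_ℓ(f)` and `a_{ℓ²}(g₀) = c²·a_{ℓ²}(f)` for a prime `ℓ ∤ N` and newforms
  `g₀ ∈ S_k(Γ₁(N₀))`, `f ∈ S_k(Γ₀(N))`, then `ε_{g₀}(ℓ) = c²` (Hecke recursions at `ℓ²` on both levels).
* §3 `rootLaw_of_uniformRootLaw` — UNIFORM (Galois currency, prime packet off any `T₀`, values `a_ℓ(W)`) ⟹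
  EIGENFORM currency (`hN2` of p647270), for the newform `f` of `W` (`aₙ(f) = aₙ(W)`).

References: [cite: BestEtAl2021, §11.1 (11.1.8)] · [cite: DiamondShurman2005, Prop. 5.8.5] ·
[cite: AtkinLi1978, Thm. 3.2] · [cite: Carayol1986, Thm. (A)].
-/

noncomputable section

open scoped MatrixGroups

open CongruenceSubgroup UpperHalfPlane Complex Function
open Literature.NumberTheory.EllipticCurves Literature.NumberTheory.EllipticCurves.ModularForms
  Literature.NumberTheory.EllipticCurves.Rank1Residual
  Summit.BirchSwinnertonDyer.BirchSwinnertonDyer.Theses.CyclotomicUntwist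

-- single-conjunct summit: `Summit.BirchSwinnertonDyer.BirchSwinnertonDyer.…` repeats the name by design
set_option linter.dupNamespace false
set_option autoImplicit false

namespace Summit.BirchSwinnertonDyer.BirchSwinnertonDyer.Theorems.PSUniformRootLawBridge

/-! ### §1 A primitive character mod `9` is not quadratic -/

section Nine

/-- The kernel of `(ℤ/9ℤ)ˣ → (ℤ/3ℤ)ˣ` has order `3`. [folklore] -/
theorem card_ker_unitsMap_nine_three :
    Nat.card (ZMod.unitsMap (show 3 ∣ 9 by norm_num)).ker = 3 := by
  have h9 : Nat.card (ZMod 9)ˣ = 6 := by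
    rw [Nat.card_eq_fintype_card, ZMod.card_units_eq_totient]; decide
  have h3 : Nat.card (ZMod 3)ˣ = 2 := by
    rw [Nat.card_eq_fintype_card, ZMod.card_units_eq_totient]; decide
  have hidx : (ZMod.unitsMap (show 3 ∣ 9 by norm_num)).ker.index = 2 := by
    rw [Subgroup.index_ker, MonoidHom.range_eq_top_of_surjective _ (ZMod.unitsMap_surjective _),
      Subgroup.card_top, h3]
  have h := (ZMod.unitsMap (show 3 ∣ 9 by norm_num)).ker.card_mul_index
  rw [hidx, h9] at h
  omega

/-- An element of the kernel of `(ℤ/9ℤ)ˣ → (ℤ/3ℤ)ˣ` is a fourth power: `x = (x²)²` (`x³ = 1`). [folklore] -/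
theorem eq_sq_sq_of_mem_ker {x : (ZMod 9)ˣ} (hx : x ∈ (ZMod.unitsMap (show 3 ∣ 9 by norm_num)).ker) :
    x = (x ^ 2) ^ 2 := by
  have h3 : x ^ 3 = 1 := by
    have h : (⟨x, hx⟩ : (ZMod.unitsMap (show 3 ∣ 9 by norm_num)).ker) ^
        Nat.card (ZMod.unitsMap (show 3 ∣ 9 by norm_num)).ker = 1 := pow_card_eq_one'
    rw [card_ker_unitsMap_nine_three] at h
    exact congrArg Subtype.val h
  calc x = x ^ 3 * x := by rw [h3, one_mul]
    _ = (x ^ 2) ^ 2 := by group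

/-- **A primitive Dirichlet character mod `9` (any integral domain of coefficients) has `η² ≠ 1`**: otherwise `η`
is trivial on the kernel of `(ℤ/9)ˣ → (ℤ/3)ˣ` (fourth powers), i.e. factors through `3`, so its conductor is
`≤ 3 < 9`. [folklore] -/
theorem sq_ne_one_of_isPrimitive_nine {R : Type*} [CommRing R] [IsDomain R] {η : DirichletCharacter R 9}
    (hη : η.IsPrimitive) : η ^ 2 ≠ 1 := by
  intro h2
  have hfac : η.FactorsThrough 3 := by
    rw [DirichletCharacter.factorsThrough_iff_ker_unitsMap (show 3 ∣ 9 by norm_num)]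
    intro x hx
    rw [MonoidHom.mem_ker, eq_sq_sq_of_mem_ker hx]
    apply Units.ext
    rw [MulChar.coe_toUnitHom, Units.val_pow_eq_pow_val, map_pow, ← MulChar.pow_apply_coe, h2,
      MulChar.one_apply_coe, Units.val_one]
  have hle : η.conductor ≤ 3 := Nat.sInf_le ((DirichletCharacter.mem_conductorSet_iff η).mpr hfac)
  rw [DirichletCharacter.isPrimitive_def] at hη
  omega

end Nine

/-! ### §2 The nebentypus from the coefficient packet (Best et al. 2021, (11.1.8)) -/

section Nebentypus

variable {N N₀ : ℕ} [NeZero N] [NeZero N₀] {k : ℤ}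
variable {f : CuspForm (Gamma0 N) k} {g₀ : CuspForm (Gamma1 N₀) k}

/-- **The nebentypus from the packet.** For newforms `f ∈ S_k(Γ₀(N))`, `g₀ ∈ S_k(Γ₁(N₀))`, a prime `ℓ ∤ N` and
`c ∈ ℂ` with `a_ℓ(g₀) = c·a_ℓ(f)` and `a_{ℓ²}(g₀) = c²·a_{ℓ²}(f)`: `ε_{g₀}(ℓ) = c²` — compare the Hecke recursions
`a_{ℓ²}(g₀) = a_ℓ(g₀)² − ε_{g₀}(ℓ)ℓ^{k−1}` and `a_{ℓ²}(f) = a_ℓ(f)² − ℓ^{k−1}`. [cite: BestEtAl2021, §11.1 (11.1.8)]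
[cite: DiamondShurman2005, Prop. 5.8.5] -/
theorem nebentypus_eq_of_packet (hf : IsNewform0 f) (hg₀ : IsNewform1 g₀) {ℓ : ℕ} (hℓ : ℓ.Prime)
    (hℓN : ¬ ℓ ∣ N) {c : ℂ} (h1 : cuspCoeff g₀ ℓ = c * cuspCoeff f ℓ)
    (h2 : cuspCoeff g₀ (ℓ ^ 2) = c ^ 2 * cuspCoeff f (ℓ ^ 2)) :
    nebentypus g₀ (ℓ : ZMod N₀) = c ^ 2 := by
  have hrg := IsNewform1.cuspCoeff_prime_pow_add_two_holds hg₀ hℓ 0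
  have hrf := hf.cuspCoeff_prime_pow_add_two_weight hℓ 0
  simp only [zero_add, pow_one, pow_zero, hg₀.cuspCoeff_one, show cuspCoeff f 1 = 1 from hf.2.2, mul_one,
    if_neg hℓN] at hrg hrf
  rw [h2, h1, hrf] at hrg
  have hℓ0 : (ℓ : ℂ) ^ (k - 1) ≠ 0 := zpow_ne_zero _ (Nat.cast_ne_zero.mpr hℓ.ne_zero)
  have hkey : (nebentypus g₀ (ℓ : ZMod N₀) - c ^ 2) * (ℓ : ℂ) ^ (k - 1) = 0 := by linear_combination hrg
  rcases mul_eq_zero.mp hkey with h | h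
  · exact sub_eq_zero.mp h
  · exact absurd h hℓ0

/-- **Nebentypus packet from the all-`n` coefficient packet**: if `aₙ(g₀) = η⁻¹(n)·aₙ(f)` for all `n` prime to
`p`, then `ε_{g₀}(ℓ) = η⁻¹(ℓ)²` for every prime `ℓ ≠ p` with `ℓ ∤ N`. [cite: BestEtAl2021, §11.1 (11.1.8)] -/
theorem nebentypus_eq_inv_sq_of_all {m p : ℕ} {η : DirichletCharacter ℂ m} (hf : IsNewform0 f)
    (hg₀ : IsNewform1 g₀) (hp : p.Prime)
    (hall : ∀ n : ℕ, ¬ p ∣ n → cuspCoeff g₀ n = η⁻¹ (n : ZMod m) * cuspCoeff f n)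
    {ℓ : ℕ} (hℓ : ℓ.Prime) (hℓp : ℓ ≠ p) (hℓN : ¬ ℓ ∣ N) :
    nebentypus g₀ (ℓ : ZMod N₀) = η⁻¹ (ℓ : ZMod m) ^ 2 := by
  have hpℓ : ¬ p ∣ ℓ := fun h ↦ hℓp ((Nat.prime_dvd_prime_iff_eq hp hℓ).mp h).symm
  have hpℓ2 : ¬ p ∣ ℓ ^ 2 := fun h ↦ hpℓ (hp.dvd_of_dvd_pow h)
  refine nebentypus_eq_of_packet hf hg₀ hℓ hℓN (hall ℓ hpℓ) ?_
  rw [hall (ℓ ^ 2) hpℓ2, Nat.cast_pow, map_pow]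

end Nebentypus

/-! ### §3 Uniform Galois currency ⟹ eigenform currency -/

section Bridge

/-- **ROOT LAW: uniform Galois currency ⟹ eigenform currency.** Input (per PS row `W`, the shape announced by the
K1 lead for `uniformRootLaw_of_print`): a primitive `η` mod `9` and `α ∈ ℂ` with `α² − a_w(W)α + 3 = 0` such that
for every `T₀ ≠ 0`, every newform `g₀` (any level `N₀`) with `a_ℓ(g₀) = η⁻¹(ℓ)·a_ℓ(W)` and `ε_{g₀}(ℓ) = η⁻¹(ℓ)²` for
all primes `ℓ ∤ T₀` has `a₃(g₀) = α`. Output: the hypothesis `hN2` of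
`PSC1OfStabilisedUntwist.psUntwistedLFunctionAtThree_of_print_of_stabilisedUntwist_of_rootLaw` — for the newform `f`
of `W`, `η² ≠ 1` (§1) and, for every newform `g₀` with `3 ∣ N₀` and `aₙ(g₀) = η⁻¹(n)aₙ(f)` for all `3 ∤ n`, the root
relation for `a₃(g₀)` (take `T₀ := 3N`; the nebentypus packet off `3N` by §2; `a_ℓ(f) = a_ℓ(W)`). [cite: BestEtAl2021, §11.1 (11.1.8)]
[cite: AtkinLi1978, Thm. 3.2] [cite: Carayol1986, Thm. (A)] -/
theorem rootLaw_of_uniformRootLaw (W : WeierstrassCurve ℚ) {N : ℕ} [NeZero N] {f : CuspForm (Gamma0 N) 2}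
    (hf : IsNewformOf W f)
    (hU : ∃ η : DirichletCharacter ℂ (3 ^ 2), η.IsPrimitive ∧ ∃ α : ℂ,
      α ^ 2 - ((W.psUntwistedTrace : ℤ) : ℂ) * α + 3 = 0 ∧
      ∀ T₀ : ℕ, T₀ ≠ 0 → ∀ {N₀ : ℕ} [NeZero N₀] (g₀ : CuspForm (Gamma1 N₀) 2), IsNewform1 g₀ →
        (∀ ℓ : ℕ, ℓ.Prime → ¬ ℓ ∣ T₀ →
          cuspCoeff g₀ ℓ = η⁻¹ (ℓ : ZMod (3 ^ 2)) * (W.LFunction ℓ : ℂ) ∧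
            nebentypus g₀ (ℓ : ZMod N₀) = η⁻¹ (ℓ : ZMod (3 ^ 2)) ^ 2) →
        cuspCoeff g₀ 3 = α) :
    ∃ η : DirichletCharacter ℂ (3 ^ 2), η.IsPrimitive ∧ η ^ 2 ≠ 1 ∧
      ∀ {N₀ : ℕ} [NeZero N₀] (g₀ : CuspForm (Gamma1 N₀) 2), IsNewform1 g₀ → 3 ∣ N₀ →
        (∀ n : ℕ, ¬ 3 ∣ n → cuspCoeff g₀ n = η⁻¹ (n : ZMod (3 ^ 2)) * cuspCoeff f n) →
        cuspCoeff g₀ 3 ^ 2 - ((W.psUntwistedTrace : ℤ) : ℂ) * cuspCoeff g₀ 3 + 3 = 0 := by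
  obtain ⟨η, hηprim, α, hαroot, hunif⟩ := hU
  refine ⟨η, hηprim, sq_ne_one_of_isPrimitive_nine (by simpa using hηprim), fun {N₀} _ g₀ hg₀ _ hall ↦ ?_⟩
  have h3 : cuspCoeff g₀ 3 = α := by
    refine hunif (3 * N) (mul_ne_zero three_ne_zero (NeZero.ne N)) g₀ hg₀ fun ℓ hℓ hℓT ↦ ?_
    have hℓ3 : ℓ ≠ 3 := by
      rintro rfl
      exact hℓT (dvd_mul_right 3 N)
    have hℓN : ¬ ℓ ∣ N := fun h ↦ hℓT (h.mul_left 3)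
    have h3ℓ : ¬ 3 ∣ ℓ := fun h ↦ hℓ3 ((Nat.prime_dvd_prime_iff_eq Nat.prime_three hℓ).mp h).symm
    refine ⟨?_, nebentypus_eq_inv_sq_of_all hf.1 hg₀ Nat.prime_three hall hℓ hℓ3 hℓN⟩
    rw [hall ℓ h3ℓ, hf.2 ℓ]
  rw [h3]
  exact hαroot

/-- **C1 `PSUntwistedLFunctionAtThree` ⟸ PRINT BY NAME + the UNIFORM ROOT LAW.** PRINT: modularity
(`nonempty_modularParametrizationData`), Carayol's level (`IsNewformOf.level_eq_conductorNorm`), Gross–Zagier I.(7.3),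
Gross–Zagier–Kolyvagin (`PublishedInputGZK`), Atkin–Li 1978 Thm. 3.2
(`Literature.NumberTheory.EllipticCurves.atkinLi_twist_newform_of_gamma0`). RESEARCH, the one remaining hypothesis
`hU` = the UNIFORM ROOT LAW on every PS row, in the Galois currency of the K1 lead's `uniformRootLaw_of_print`
(announced 2026-08-28T16:20Z; Deligne + Carayol (A) + the inertia analysis over `ℚ₃(ζ₉)`): `∃ η` primitive mod `9`,
`∃ α` with `α² − a_w(W)α + 3 = 0`, such that for every `T₀ ≠ 0` every newform `g₀` with `a_ℓ(g₀) = η⁻¹(ℓ)a_ℓ(W)`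
and `ε_{g₀}(ℓ) = η⁻¹(ℓ)²` at all primes `ℓ ∤ T₀` has `a₃(g₀) = α`. Chain: `rootLaw_of_uniformRootLaw` ⟹ the
eigenform-currency root law ⟹ `PSStabilisedUntwistOfAtkinLi.psUntwistedLFunctionAtThree_of_print_of_atkinLi_of_rootLaw`
(p648095). The conclusion is the crux child C1 VERBATIM; BSD is not proved by this; C1 stays conditional on `hU`.
[cite: AtkinLi1978, Thm. 3.2] [cite: Carayol1986, Thm. (A)] [cite: MazurTateTeitelbaum1986Invent, §I.14 (case p ∣ N)]
[cite: GrossZagier1986, Thm. I.(7.3)] -/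
theorem psUntwistedLFunctionAtThree_of_print_of_atkinLi_of_uniformRootLaw
    (hmod : nonempty_modularParametrizationData)
    (hlev : ∀ (N : ℕ) [NeZero N], IsNewformOf.level_eq_conductorNorm (N := N))
    (hGZ86 : GrossZagier1986_thm_I_7_3) (hGZK : PublishedInputGZK)
    (hAL : Literature.NumberTheory.EllipticCurves.atkinLi_twist_newform_of_gamma0)
    (hU : ∀ (W : WeierstrassCurve ℚ) [W.IsElliptic] [W.IsGloballyMinimal], ¬ W.HasCM →
      Summit.BirchSwinnertonDyer.Rank1Residual.Additive.ClassO6 W 3 → Surj W 3 →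
      Even (padicValInt 3 W.minimalDiscriminantInt) →
      W.minimalDiscriminantInt / 3 ^ padicValInt 3 W.minimalDiscriminantInt % 3 = 1 →
      W.analyticRank = 1 →
      ∃ η : DirichletCharacter ℂ (3 ^ 2), η.IsPrimitive ∧ ∃ α : ℂ,
        α ^ 2 - ((W.psUntwistedTrace : ℤ) : ℂ) * α + 3 = 0 ∧
        ∀ T₀ : ℕ, T₀ ≠ 0 → ∀ {N₀ : ℕ} [NeZero N₀] (g₀ : CuspForm (Gamma1 N₀) 2), IsNewform1 g₀ →
          (∀ ℓ : ℕ, ℓ.Prime → ¬ ℓ ∣ T₀ →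
            cuspCoeff g₀ ℓ = η⁻¹ (ℓ : ZMod (3 ^ 2)) * (W.LFunction ℓ : ℂ) ∧
              nebentypus g₀ (ℓ : ZMod N₀) = η⁻¹ (ℓ : ZMod (3 ^ 2)) ^ 2) →
          cuspCoeff g₀ 3 = α) :
    PSUntwistedLFunctionAtThree :=
  PSStabilisedUntwistOfAtkinLi.psUntwistedLFunctionAtThree_of_print_of_atkinLi_of_rootLaw hmod hlev hGZ86 hGZK hAL
    fun W _ _ hCM hO6 hsurj hev hsq hr _N _ _f hf ↦
      rootLaw_of_uniformRootLaw W hf (hU W hCM hO6 hsurj hev hsq hr)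

end Bridge

end Summit.BirchSwinnertonDyer.BirchSwinnertonDyer.Theorems.PSUniformRootLawBridge

end
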